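import Literature.NumberTheory.Automorphic.ValuedFieldValuativeRelBridge         -- ★ `v_le_one_iff_mem_integer` (`Valued.v` ↔ the `ValuativeRel` integers `𝒪[K]`)
import Literature.NumberTheory.Rogawski1990.RankOneTorusDepthContinuity          -- ★ (b3) F0P3a-p03: `continuous_frameEntry_apply`, `conjLocal_frameEntry_mul_self_apply`; brings ★ `valued_apply_eq_one_of_conjLocal_mul_self`, ★ `toPlace_uniformizer_ne_zero`, the `cmDatum` carriers
import HarnessLib

/-!
# (β) HEAD ED. 2, sub-assembly S3 «LOCAL CONSTANCY OF THE COEFFICIENTS» of the depth-expansion package `hD`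
# (road «R1LL-tree», Rogawski 1990 §4.9 Lemma 4.9.3; Labesse–Langlands 1979 §2; Bernstein–Zelevinsky 1976 §1.1)

Topic `NumberTheory/Rogawski1990` (§2) and `NumberTheory/Automorphic` (§1, generic); THEOREMS ONLY (no definition, no instance, no notation, no named fact, no
`sorry`); kernel lane.  Cell `pub/hodgecm-mathlib`, crux H413 = `stmt-HodgeConjecture-24833`, road «R1LL-tree» (architect A-p16 (g27), RULINGS A-20∕A-21 (a)),
(β) HEAD ED. 2 `rankOneUnstable_core_inert` (owner F0P3-p01 (g14); plan of record = F0P3a-p08 (g14)'s census `CENSUS-beta-HeadED2` §2, bricks S0–S5).  This file is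
brick S3.  HONEST LABEL: HC_CM is proved only modulo the 2 remaining named inputs (hLiu418, h413) until rung 0 closes; this file is topological bookkeeping on
`H_v = U(Φ₂)(L⁺_v) × U(Φ₁)(L⁺_v)` along the elliptic torus `Z(t₀)` and asserts nothing printed.

THE MATHEMATICS.  `v` a finite place of `L⁺` non-split (`c • w = w`) and unramified in the CM field `L`, `H_v = H₂ × H₁`, `E₂ : H₂ ≃ₜ* U` ANY topological-group
isomorphism onto the one-place model `U = U(σ_w, (Φ₂)_w)(L_w) ≤ GL₂(L_w)` (e.g. ★ `localNonsplitEquiv`), `ϖ_w = ι_w(ϖ_v)`.  The LEVEL-`m` SET of `U` is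
`{y ∈ U | ϖ_w^{−m}(y − 1) ∈ M₂(𝒪_w)}` — literally the antecedent of the binder `hKm` of ★ (H3) `finsum_fixedBy_conj_eq_depthExpansion_at` (A-p13 (g31), p843465) and of
A-p16 (g27)'s S2 package `RankOneKappaLevelFamilyCM` (`mem_localCongruenceSubgroup_of_forall_zpow_neg_mul_sub_one_mem`, `exists_level_forall_mul_onePlace_eq`), which
provides, for the finitely many cover pieces `φ_k ∈ C_c^∞(H_v)`, a common `m ≥ 1` with `φ_k (x · (E₂⁻¹ y, 1)) = φ_k x` for all `y` of level `m`.
In the fold (S5) the coefficient functions of ★ HEAD ED. 1 `rankOneUnstable_core_inert_of_depthExpansion` are finite signed sums of the VALUES of the pieces at the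
normal-form points of ★ (H3)∕(H4): `t ↦ φ_k (E₂⁻¹ (X t), t.2)` with `↑↑(X t) = τ_i(t)_w • M` for a FIXED matrix `M` (`M = 1`, `1 + ϖ_w^i N_δ`, `1 + ϖ_w^{i−1} N_δ`), where
`τ_i(t) = (P⁻¹ t.1 P)_{ii}` is the `i`-th frame eigenvalue of `t ∈ Z(t₀)`.  THIS FILE proves such functions are LOCALLY CONSTANT on `Z(t₀)`, SECTION-FREE:
`X t′ = X t · q` with `↑↑q = (τ_i(t′)_w ∕ τ_i(t)_w) • 1`, and `q` is of level `m` as soon as `v_w(τ_i(t′)_w − τ_i(t)_w) ≤ v_w(ϖ_w)^m` (★ `continuous_frameEntry_apply`,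
`v_w(τ_i(t)_w) = 1` ★ `valued_apply_eq_one_of_conjLocal_mul_self`); the second component moves continuously and `φ_k` is locally constant there.
[Rogawski 1990 §4.9 p. 56: the germ `c(γ)` of Lemma 4.9.3 is locally constant on the torus; Labesse–Langlands 1979 §2; Bernstein–Zelevinsky 1976 §1.1.]

* §1 (generic) `zpow_neg_mul_mem_integer_iff` — the level condition in valuation form `ϖ^{−m} x ∈ 𝒪 ↔ v(x) ≤ v(ϖ)^m`; `isLocallyConstant_finset_sum` (finite sums of
  locally constant functions; the shape of `φm`, `φ i` in ★ HEAD ED. 1).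
* §2 **S3** `isLocallyConstant_apply_symm_frameScalar` (statement in the module text above; binders: the S2 right-level invariance in the level-set form, `IsLocallyConstant ψ`,
  the torus frame data `t₀ P d ht₀ hP hd1` of ★ p843033, an index `i : Fin 2`, the fixed matrix `M`, the witness map `X` with its matrix law, a continuous second
  component `b`), and the corollary `isLocallyConstant_apply_symm_frameScalar_snd` at `b t := t.2`.

## References
* [Rogawski1990] J. D. Rogawski, *Automorphic Representations of Unitary Groups in Three Variables*, Ann. of Math. Stud. 123 (1990): §4.9 Lemma 4.9.3 p. 56; §3.6
  pp. 31–32; §1.6 p. 6.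
* [LabesseLanglands1979] J.-P. Labesse, R. P. Langlands, *L-indistinguishability for SL(2)*, Canad. J. Math. 31 (1979): §2.
* [BernsteinZelevinsky1976] I. N. Bernstein, A. V. Zelevinsky, *Representations of the group GL(n, F) where F is a non-archimedean local field*, Russian Math.
  Surveys 31 (1976): §1.1.
-/

set_option autoImplicit false

noncomputable section

open Topology Filter Set NumberField IsDedekindDomain Matrix ValuativeRel
open scoped ValuativeRel Matrix MatrixGroups WithZero

/-! ## §1 Generic bookkeeping -/

namespace Literature.NumberTheory.Automorphic

section Level

variable {K : Type*} [Field K] [Valued K ℤᵐ⁰] [ValuativeRel K] [(Valued.v : Valuation K ℤᵐ⁰).Compatible]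

/-- **The level condition in valuation form**: `ϖ^{−m} x ∈ 𝒪 ↔ v(x) ≤ v(ϖ)^m` (`ϖ ≠ 0`; `𝒪` the integers of the valuative relation, ★ `v_le_one_iff_mem_integer`).
[cite: BernsteinZelevinsky1976, §1.1] -/
theorem zpow_neg_mul_mem_integer_iff {ϖ : K} (hϖ : ϖ ≠ 0) (m : ℕ) (x : K) :
    ϖ ^ (-(m : ℤ)) * x ∈ 𝒪[K] ↔ Valued.v x ≤ Valued.v ϖ ^ m := by
  rw [← v_le_one_iff_mem_integer, map_mul, map_zpow₀, _root_.zpow_neg, zpow_natCast]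
  have h0 : (Valued.v ϖ : ℤᵐ⁰) ^ m ≠ 0 := pow_ne_zero _ ((Valuation.ne_zero_iff _).2 hϖ)
  rw [inv_mul_le_iff₀ (zero_lt_iff.2 h0), mul_one]

end Level

/-- **Finite sums of locally constant functions are locally constant** (Mathlib has `IsLocallyConstant.add`; this is its `Finset` iterate — the shape of the
coefficient functions `φm = Σ_k (−1)^{e_k} ν(K_k) ψm_k`, `φ i = Σ_k (−1)^{e_k} ν(K_k) ψ_k i` of ★ HEAD ED. 1; the locally constant functions form a
vector space). [cite: BernsteinZelevinsky1976, §1.1] -/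
theorem isLocallyConstant_finset_sum {X : Type*} [TopologicalSpace X] {Y : Type*} [AddCommMonoid Y] {ι : Type*} (s : Finset ι) (f : ι → X → Y)
    (hf : ∀ i ∈ s, IsLocallyConstant (f i)) : IsLocallyConstant (fun x => ∑ i ∈ s, f i x) := by
  classical
  induction s using Finset.induction_on with
  | empty => simp only [Finset.sum_empty]; exact IsLocallyConstant.const 0
  | insert a s ha ih =>
    simp only [Finset.sum_insert ha]
    exact (hf a (Finset.mem_insert_self a s)).add (ih fun i hi => hf i (Finset.mem_insert_of_mem hi))

/-- A product of a constant and a locally constant function is locally constant (the summands `(−1)^{e_k} ν(K_k) · ψ_k` of `φm`, `φ i`; the locally constant functions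
form a module). [cite: BernsteinZelevinsky1976, §1.1] -/
theorem isLocallyConstant_const_mul {X : Type*} [TopologicalSpace X] {Y : Type*} [Mul Y] (c : Y) {f : X → Y} (hf : IsLocallyConstant f) :
    IsLocallyConstant (fun x => c * f x) :=
  (IsLocallyConstant.const c).mul hf

end Literature.NumberTheory.Automorphic

/-! ## §2 S3 «LOCAL CONSTANCY OF THE COEFFICIENTS» along the elliptic torus `Z(t₀)` — section-free -/

namespace Literature.NumberTheory.Rogawski1990

open Literature.NumberTheory.Automorphic Literature.NumberTheory.Automorphic.UnitaryGroup Literature.NumberTheory.GaloisRepresentations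

section Coefficients

variable (L : Type) [Field L] [NumberField L] [IsCMField L] (v : HeightOneSpectrum (𝓞 ↥(maximalRealSubfield L)))
  (w : PlacesOver L v) (hw : IsCMField.complexConj L • w.1 = w.1) (hunr : Algebra.IsUnramifiedIn (𝓞 L) v.asIdeal)
  (t₀ : ((cmDatum L 2 (Matrix.of fun i j : Fin 2 => if i.val + j.val + 1 = 2 then (1 : L) else 0)).Local v × (cmDatum L 1 (Matrix.of fun i j : Fin 1 => if i.val + j.val + 1 = 1 then (1 : L) else 0)).Local v))
  (P : GL (Fin 2) (LocalRing L v)) (d : Fin 2 → LocalRing L v) (ht₀ : IsRegularElt (t₀.1.val : GL (Fin 2) (LocalRing L v)))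
  (hP : (t₀.1.val.val : Matrix (Fin 2) (Fin 2) (LocalRing L v)) * P.val = P.val * Matrix.diagonal d) (hd1 : ∀ i, conjLocal L (IsCMField.complexConj L) v (d i) * d i = 1)

include hw hunr ht₀ hP hd1 in
/-- **S3 «LOCAL CONSTANCY OF THE COEFFICIENTS» (census `CENSUS-beta-HeadED2` §2), section-free form.**  Let `ψ : H_v → Y` be LOCALLY CONSTANT and invariant under right
translation by `(E₂⁻¹ y, 1)` for every `y ∈ U` of level `m` (`ϖ_w^{−m}(y − 1) ∈ M₂(𝒪_w)` — the S2 package of A-p16 (g27), in the level-set form that is also ★ (H3)'s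
`hKm` antecedent).  Let `X : Z(t₀) → U` have matrix `↑↑(X t) = τ_i(t)_w • M` for a FIXED `M` (`τ_i(t) = (P⁻¹ t.1 P)_{ii}`; ★ (H3)∕(H4)'s normal-form witnesses read along
the torus), and `b : Z(t₀) → U(Φ₁)(L⁺_v)` be continuous.  Then `t ↦ ψ (E₂⁻¹ (X t), b t)` is locally constant on `Z(t₀)`: near `t`, `X t′ = X t · q` with
`↑↑q = (τ_i(t′)_w ∕ τ_i(t)_w) • 1` of level `m` (`v_w(τ_i(t′)_w − τ_i(t)_w) ≤ v_w(ϖ_w)^m` by continuity ★ `continuous_frameEntry_apply` and `v_w(τ_i(t)_w) = 1`), so the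
first argument may be frozen at `X t`; then `ψ` is locally constant in the second.  No continuous section of `U` is used.
[cite: Rogawski1990, §4.9 Lemma 4.9.3 p. 56; §3.6 pp. 31–32] [cite: LabesseLanglands1979, §2] [cite: BernsteinZelevinsky1976, §1.1] -/
theorem isLocallyConstant_apply_symm_frameScalar {Y : Type*}
    (E₂ : (cmDatum L 2 (Matrix.of fun i j : Fin 2 => if i.val + j.val + 1 = 2 then (1 : L) else 0)).Local v ≃ₜ*
      ↥(unitaryGroupOfForm (galAdicCompletionMap (L := L) (IsCMField.complexConj L) hw)
        (placeForm (Matrix.of fun i j : Fin 2 => if i.val + j.val + 1 = 2 then (1 : L) else 0) w.1)))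
    (ψ : ((cmDatum L 2 (Matrix.of fun i j : Fin 2 => if i.val + j.val + 1 = 2 then (1 : L) else 0)).Local v × (cmDatum L 1 (Matrix.of fun i j : Fin 1 => if i.val + j.val + 1 = 1 then (1 : L) else 0)).Local v) → Y)
    (hψlc : IsLocallyConstant ψ) (m : ℕ)
    (hψ : ∀ (x : ((cmDatum L 2 (Matrix.of fun i j : Fin 2 => if i.val + j.val + 1 = 2 then (1 : L) else 0)).Local v × (cmDatum L 1 (Matrix.of fun i j : Fin 1 => if i.val + j.val + 1 = 1 then (1 : L) else 0)).Local v))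
        (y : ↥(unitaryGroupOfForm (galAdicCompletionMap (L := L) (IsCMField.complexConj L) hw) (placeForm (Matrix.of fun i j : Fin 2 => if i.val + j.val + 1 = 2 then (1 : L) else 0) w.1))),
        (∀ r s, toPlace v w (HeckeCharacter.uniformizer ↥(maximalRealSubfield L) v : v.adicCompletion ↥(maximalRealSubfield L)) ^ (-(m : ℤ)) *
          ((((y : ↥(unitaryGroupOfForm (galAdicCompletionMap (L := L) (IsCMField.complexConj L) hw) (placeForm (Matrix.of fun i j : Fin 2 => if i.val + j.val + 1 = 2 then (1 : L) else 0) w.1))) : GL (Fin 2) (w.1.adicCompletion L)) : Matrix (Fin 2) (Fin 2) (w.1.adicCompletion L)) - 1) r s ∈ 𝒪[w.1.adicCompletion L]) →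
        ψ (x * (E₂.symm y, 1)) = ψ x)
    (i : Fin 2) (M : Matrix (Fin 2) (Fin 2) (w.1.adicCompletion L))
    (X : ↥(Subgroup.centralizer ({t₀} : Set ((cmDatum L 2 (Matrix.of fun i j : Fin 2 => if i.val + j.val + 1 = 2 then (1 : L) else 0)).Local v × (cmDatum L 1 (Matrix.of fun i j : Fin 1 => if i.val + j.val + 1 = 1 then (1 : L) else 0)).Local v))) →
      ↥(unitaryGroupOfForm (galAdicCompletionMap (L := L) (IsCMField.complexConj L) hw) (placeForm (Matrix.of fun i j : Fin 2 => if i.val + j.val + 1 = 2 then (1 : L) else 0) w.1)))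
    (hX : ∀ t, (((X t : ↥(unitaryGroupOfForm (galAdicCompletionMap (L := L) (IsCMField.complexConj L) hw) (placeForm (Matrix.of fun i j : Fin 2 => if i.val + j.val + 1 = 2 then (1 : L) else 0) w.1))) : GL (Fin 2) (w.1.adicCompletion L)) : Matrix (Fin 2) (Fin 2) (w.1.adicCompletion L)) =
      ((((P⁻¹).val * ((t : ((cmDatum L 2 (Matrix.of fun i j : Fin 2 => if i.val + j.val + 1 = 2 then (1 : L) else 0)).Local v × (cmDatum L 1 (Matrix.of fun i j : Fin 1 => if i.val + j.val + 1 = 1 then (1 : L) else 0)).Local v)).1.val.val : Matrix (Fin 2) (Fin 2) (LocalRing L v)) * P.val) i i) w) • M)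
    (b : ↥(Subgroup.centralizer ({t₀} : Set ((cmDatum L 2 (Matrix.of fun i j : Fin 2 => if i.val + j.val + 1 = 2 then (1 : L) else 0)).Local v × (cmDatum L 1 (Matrix.of fun i j : Fin 1 => if i.val + j.val + 1 = 1 then (1 : L) else 0)).Local v))) →
      (cmDatum L 1 (Matrix.of fun i j : Fin 1 => if i.val + j.val + 1 = 1 then (1 : L) else 0)).Local v)
    (hb : Continuous b) :
    IsLocallyConstant (fun t : ↥(Subgroup.centralizer ({t₀} : Set ((cmDatum L 2 (Matrix.of fun i j : Fin 2 => if i.val + j.val + 1 = 2 then (1 : L) else 0)).Local v × (cmDatum L 1 (Matrix.of fun i j : Fin 1 => if i.val + j.val + 1 = 1 then (1 : L) else 0)).Local v))) =>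
      ψ (E₂.symm (X t), b t)) := by
  refine (IsLocallyConstant.iff_eventually_eq _).2 fun t => ?_
  -- the frame eigenvalue `c t = τ_i(t)_w`, abstracted: continuous, of valuation one, non-zero
  obtain ⟨c, hc_def⟩ : ∃ c : ↥(Subgroup.centralizer ({t₀} : Set ((cmDatum L 2 (Matrix.of fun i j : Fin 2 => if i.val + j.val + 1 = 2 then (1 : L) else 0)).Local v × (cmDatum L 1 (Matrix.of fun i j : Fin 1 => if i.val + j.val + 1 = 1 then (1 : L) else 0)).Local v))) → w.1.adicCompletion L,
      ∀ t, c t = (((P⁻¹).val * ((t : ((cmDatum L 2 (Matrix.of fun i j : Fin 2 => if i.val + j.val + 1 = 2 then (1 : L) else 0)).Local v × (cmDatum L 1 (Matrix.of fun i j : Fin 1 => if i.val + j.val + 1 = 1 then (1 : L) else 0)).Local v)).1.val.val : Matrix (Fin 2) (Fin 2) (LocalRing L v)) * P.val) i i) w := ⟨_, fun _ => rfl⟩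
  have hX' : ∀ t, (((X t : ↥(unitaryGroupOfForm (galAdicCompletionMap (L := L) (IsCMField.complexConj L) hw) (placeForm (Matrix.of fun i j : Fin 2 => if i.val + j.val + 1 = 2 then (1 : L) else 0) w.1))) : GL (Fin 2) (w.1.adicCompletion L)) : Matrix (Fin 2) (Fin 2) (w.1.adicCompletion L)) = c t • M := fun t => by
    rw [hc_def]; exact hX t
  have hc : Continuous c := by
    rw [show c = fun t : ↥(Subgroup.centralizer ({t₀} : Set ((cmDatum L 2 (Matrix.of fun i j : Fin 2 => if i.val + j.val + 1 = 2 then (1 : L) else 0)).Local v × (cmDatum L 1 (Matrix.of fun i j : Fin 1 => if i.val + j.val + 1 = 1 then (1 : L) else 0)).Local v))) => (((P⁻¹).val * ((t : ((cmDatum L 2 (Matrix.of fun i j : Fin 2 => if i.val + j.val + 1 = 2 then (1 : L) else 0)).Local v × (cmDatum L 1 (Matrix.of fun i j : Fin 1 => if i.val + j.val + 1 = 1 then (1 : L) else 0)).Local v)).1.val.val : Matrix (Fin 2) (Fin 2) (LocalRing L v)) * P.val) i i) w from funext hc_def]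
    exact (continuous_frameEntry_apply L v P i i w).comp continuous_subtype_val
  have hc1 : ∀ t, Valued.v (c t) = 1 := fun t => by
    rw [hc_def]; exact valued_apply_eq_one_of_conjLocal_mul_self L v w hw (conjLocal_frameEntry_mul_self_apply L v w hw t₀ P d ht₀ hP hd1 t i)
  have hc0 : ∀ t, c t ≠ 0 := fun t h => by
    have h1 := hc1 t
    rw [h, map_zero] at h1
    exact zero_ne_one h1
  have hϖ0 := toPlace_uniformizer_ne_zero L v w hunr
  -- (1) eventually the eigenvalue moves by less than `ϖ_w^m` (through the normalised absolute value of `L_w`)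
  have h1 : ∀ᶠ t' : ↥(Subgroup.centralizer ({t₀} : Set ((cmDatum L 2 (Matrix.of fun i j : Fin 2 => if i.val + j.val + 1 = 2 then (1 : L) else 0)).Local v × (cmDatum L 1 (Matrix.of fun i j : Fin 1 => if i.val + j.val + 1 = 1 then (1 : L) else 0)).Local v))) in 𝓝 t, Valued.v (c t' - c t) < Valued.v (toPlace v w (HeckeCharacter.uniformizer ↥(maximalRealSubfield L) v : v.adicCompletion ↥(maximalRealSubfield L))) ^ m := by
    have ht : Tendsto (fun t' : ↥(Subgroup.centralizer ({t₀} : Set ((cmDatum L 2 (Matrix.of fun i j : Fin 2 => if i.val + j.val + 1 = 2 then (1 : L) else 0)).Local v × (cmDatum L 1 (Matrix.of fun i j : Fin 1 => if i.val + j.val + 1 = 1 then (1 : L) else 0)).Local v))) => c t' - c t) (𝓝 t) (𝓝 0) := by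
      have h := (hc.tendsto t).sub_const (c t)
      rwa [sub_self] at h
    have hπ' : 0 < ‖(toPlace v w (HeckeCharacter.uniformizer ↥(maximalRealSubfield L) v : v.adicCompletion ↥(maximalRealSubfield L))) ^ m‖ := norm_pos_iff.2 (pow_ne_zero m hϖ0)
    filter_upwards [(NormedAddGroup.tendsto_nhds_zero.1 ht) _ hπ'] with t' ht'
    rw [← map_pow]
    exact Valued.toNormedField.norm_lt_iff.1 ht'
  -- (2) eventually the second component stays where `ψ (E₂⁻¹ (X t), ·)` is constant
  have h2 : ∀ᶠ t' : ↥(Subgroup.centralizer ({t₀} : Set ((cmDatum L 2 (Matrix.of fun i j : Fin 2 => if i.val + j.val + 1 = 2 then (1 : L) else 0)).Local v × (cmDatum L 1 (Matrix.of fun i j : Fin 1 => if i.val + j.val + 1 = 1 then (1 : L) else 0)).Local v))) in 𝓝 t, ψ (E₂.symm (X t), b t') = ψ (E₂.symm (X t), b t) := by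
    have hlc : IsLocallyConstant (fun a : (cmDatum L 1 (Matrix.of fun i j : Fin 1 => if i.val + j.val + 1 = 1 then (1 : L) else 0)).Local v => ψ (E₂.symm (X t), a)) :=
      hψlc.comp_continuous (continuous_const.prodMk continuous_id)
    exact (hb.tendsto t).eventually ((IsLocallyConstant.iff_eventually_eq _).1 hlc (b t))
  filter_upwards [h1, h2] with t' h1' h2'
  -- the quotient `q := (X t)⁻¹ * X t'` is the scalar `(c t' / c t) • 1`
  have hXt' : (((X t' : ↥(unitaryGroupOfForm (galAdicCompletionMap (L := L) (IsCMField.complexConj L) hw) (placeForm (Matrix.of fun i j : Fin 2 => if i.val + j.val + 1 = 2 then (1 : L) else 0) w.1))) : GL (Fin 2) (w.1.adicCompletion L)) : Matrix (Fin 2) (Fin 2) (w.1.adicCompletion L)) =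
      (((X t : ↥(unitaryGroupOfForm (galAdicCompletionMap (L := L) (IsCMField.complexConj L) hw) (placeForm (Matrix.of fun i j : Fin 2 => if i.val + j.val + 1 = 2 then (1 : L) else 0) w.1))) : GL (Fin 2) (w.1.adicCompletion L)) : Matrix (Fin 2) (Fin 2) (w.1.adicCompletion L)) * ((c t' / c t) • (1 : Matrix (Fin 2) (Fin 2) (w.1.adicCompletion L))) := by
    rw [hX' t', hX' t, Matrix.smul_mul, Matrix.mul_smul, Matrix.mul_one, smul_smul, mul_div_assoc', mul_div_cancel_left₀ _ (hc0 t)]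
  have hq : ((((X t)⁻¹ * X t' : ↥(unitaryGroupOfForm (galAdicCompletionMap (L := L) (IsCMField.complexConj L) hw) (placeForm (Matrix.of fun i j : Fin 2 => if i.val + j.val + 1 = 2 then (1 : L) else 0) w.1))) : GL (Fin 2) (w.1.adicCompletion L)) : Matrix (Fin 2) (Fin 2) (w.1.adicCompletion L)) =
      (c t' / c t) • (1 : Matrix (Fin 2) (Fin 2) (w.1.adicCompletion L)) := by
    rw [Subgroup.coe_mul, Subgroup.coe_inv, Units.val_mul, hXt', Units.inv_mul_cancel_left]
  -- hence `q` is of level `m`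
  have hlev : ∀ r s, (toPlace v w (HeckeCharacter.uniformizer ↥(maximalRealSubfield L) v : v.adicCompletion ↥(maximalRealSubfield L))) ^ (-(m : ℤ)) *
      (((((X t)⁻¹ * X t' : ↥(unitaryGroupOfForm (galAdicCompletionMap (L := L) (IsCMField.complexConj L) hw) (placeForm (Matrix.of fun i j : Fin 2 => if i.val + j.val + 1 = 2 then (1 : L) else 0) w.1))) : GL (Fin 2) (w.1.adicCompletion L)) : Matrix (Fin 2) (Fin 2) (w.1.adicCompletion L)) - 1) r s ∈ 𝒪[w.1.adicCompletion L] := by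
    intro r s
    have hsub : ∀ a : w.1.adicCompletion L, a • (1 : Matrix (Fin 2) (Fin 2) (w.1.adicCompletion L)) - 1 = (a - 1) • (1 : Matrix (Fin 2) (Fin 2) (w.1.adicCompletion L)) :=
      fun a => by rw [sub_smul, one_smul]
    rw [hq, hsub, Matrix.smul_apply, Matrix.one_apply, smul_eq_mul]
    split_ifs with hrs
    · rw [mul_one, zpow_neg_mul_mem_integer_iff hϖ0, div_sub_one (hc0 t), map_div₀, hc1 t, div_one]
      exact h1'.le
    · rw [mul_zero, mul_zero]
      exact (Valuation.mem_integer_iff _ _).2 (by rw [map_zero]; exact zero_le)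
  -- conclude: freeze the first argument by the S2 invariance, then move the second
  have hXq : X t' = X t * ((X t)⁻¹ * X t') := by rw [mul_inv_cancel_left]
  calc ψ (E₂.symm (X t'), b t')
      = ψ ((E₂.symm (X t), b t') * (E₂.symm ((X t)⁻¹ * X t'), 1)) := by
        rw [Prod.mk_mul_mk, ← map_mul, ← hXq, mul_one]
    _ = ψ (E₂.symm (X t), b t') := hψ _ _ hlev
    _ = ψ (E₂.symm (X t), b t) := h2'

include hw hunr ht₀ hP hd1 in
/-- **S3 at the torus' own second component** `b t := t.2` (the shape used by the fold S5: `ψm_k t = φ_k (E₂⁻¹ (xm t), t.2)`, `ψ_k i t = φ_k (E₂⁻¹ (x i t), t.2)`).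
[cite: Rogawski1990, §4.9 Lemma 4.9.3 p. 56] [cite: LabesseLanglands1979, §2] -/
theorem isLocallyConstant_apply_symm_frameScalar_snd {Y : Type*}
    (E₂ : (cmDatum L 2 (Matrix.of fun i j : Fin 2 => if i.val + j.val + 1 = 2 then (1 : L) else 0)).Local v ≃ₜ*
      ↥(unitaryGroupOfForm (galAdicCompletionMap (L := L) (IsCMField.complexConj L) hw)
        (placeForm (Matrix.of fun i j : Fin 2 => if i.val + j.val + 1 = 2 then (1 : L) else 0) w.1)))
    (ψ : ((cmDatum L 2 (Matrix.of fun i j : Fin 2 => if i.val + j.val + 1 = 2 then (1 : L) else 0)).Local v × (cmDatum L 1 (Matrix.of fun i j : Fin 1 => if i.val + j.val + 1 = 1 then (1 : L) else 0)).Local v) → Y)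
    (hψlc : IsLocallyConstant ψ) (m : ℕ)
    (hψ : ∀ (x : ((cmDatum L 2 (Matrix.of fun i j : Fin 2 => if i.val + j.val + 1 = 2 then (1 : L) else 0)).Local v × (cmDatum L 1 (Matrix.of fun i j : Fin 1 => if i.val + j.val + 1 = 1 then (1 : L) else 0)).Local v))
        (y : ↥(unitaryGroupOfForm (galAdicCompletionMap (L := L) (IsCMField.complexConj L) hw) (placeForm (Matrix.of fun i j : Fin 2 => if i.val + j.val + 1 = 2 then (1 : L) else 0) w.1))),
        (∀ r s, toPlace v w (HeckeCharacter.uniformizer ↥(maximalRealSubfield L) v : v.adicCompletion ↥(maximalRealSubfield L)) ^ (-(m : ℤ)) *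
          ((((y : ↥(unitaryGroupOfForm (galAdicCompletionMap (L := L) (IsCMField.complexConj L) hw) (placeForm (Matrix.of fun i j : Fin 2 => if i.val + j.val + 1 = 2 then (1 : L) else 0) w.1))) : GL (Fin 2) (w.1.adicCompletion L)) : Matrix (Fin 2) (Fin 2) (w.1.adicCompletion L)) - 1) r s ∈ 𝒪[w.1.adicCompletion L]) →
        ψ (x * (E₂.symm y, 1)) = ψ x)
    (i : Fin 2) (M : Matrix (Fin 2) (Fin 2) (w.1.adicCompletion L))
    (X : ↥(Subgroup.centralizer ({t₀} : Set ((cmDatum L 2 (Matrix.of fun i j : Fin 2 => if i.val + j.val + 1 = 2 then (1 : L) else 0)).Local v × (cmDatum L 1 (Matrix.of fun i j : Fin 1 => if i.val + j.val + 1 = 1 then (1 : L) else 0)).Local v))) →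
      ↥(unitaryGroupOfForm (galAdicCompletionMap (L := L) (IsCMField.complexConj L) hw) (placeForm (Matrix.of fun i j : Fin 2 => if i.val + j.val + 1 = 2 then (1 : L) else 0) w.1)))
    (hX : ∀ t, (((X t : ↥(unitaryGroupOfForm (galAdicCompletionMap (L := L) (IsCMField.complexConj L) hw) (placeForm (Matrix.of fun i j : Fin 2 => if i.val + j.val + 1 = 2 then (1 : L) else 0) w.1))) : GL (Fin 2) (w.1.adicCompletion L)) : Matrix (Fin 2) (Fin 2) (w.1.adicCompletion L)) =
      ((((P⁻¹).val * ((t : ((cmDatum L 2 (Matrix.of fun i j : Fin 2 => if i.val + j.val + 1 = 2 then (1 : L) else 0)).Local v × (cmDatum L 1 (Matrix.of fun i j : Fin 1 => if i.val + j.val + 1 = 1 then (1 : L) else 0)).Local v)).1.val.val : Matrix (Fin 2) (Fin 2) (LocalRing L v)) * P.val) i i) w) • M) :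
    IsLocallyConstant (fun t : ↥(Subgroup.centralizer ({t₀} : Set ((cmDatum L 2 (Matrix.of fun i j : Fin 2 => if i.val + j.val + 1 = 2 then (1 : L) else 0)).Local v × (cmDatum L 1 (Matrix.of fun i j : Fin 1 => if i.val + j.val + 1 = 1 then (1 : L) else 0)).Local v))) =>
      ψ (E₂.symm (X t), (t : ((cmDatum L 2 (Matrix.of fun i j : Fin 2 => if i.val + j.val + 1 = 2 then (1 : L) else 0)).Local v × (cmDatum L 1 (Matrix.of fun i j : Fin 1 => if i.val + j.val + 1 = 1 then (1 : L) else 0)).Local v)).2)) :=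
  isLocallyConstant_apply_symm_frameScalar L v w hw hunr t₀ P d ht₀ hP hd1 E₂ ψ hψlc m hψ i M X hX _ (continuous_snd.comp continuous_subtype_val)

end Coefficients

/-! ## §3 (ED. 2) The same with an ARBITRARY non-zero level element — no `hunr` (ramified places: (R5b-β)) -/

section CoefficientsOfNeZero

variable (L : Type) [Field L] [NumberField L] [IsCMField L] (v : HeightOneSpectrum (𝓞 ↥(maximalRealSubfield L)))
  (w : PlacesOver L v) (hw : IsCMField.complexConj L • w.1 = w.1)
  (t₀ : ((cmDatum L 2 (Matrix.of fun i j : Fin 2 => if i.val + j.val + 1 = 2 then (1 : L) else 0)).Local v × (cmDatum L 1 (Matrix.of fun i j : Fin 1 => if i.val + j.val + 1 = 1 then (1 : L) else 0)).Local v))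
  (P : GL (Fin 2) (LocalRing L v)) (d : Fin 2 → LocalRing L v) (ht₀ : IsRegularElt (t₀.1.val : GL (Fin 2) (LocalRing L v)))
  (hP : (t₀.1.val.val : Matrix (Fin 2) (Fin 2) (LocalRing L v)) * P.val = P.val * Matrix.diagonal d) (hd1 : ∀ i, conjLocal L (IsCMField.complexConj L) v (d i) * d i = 1)

include hw ht₀ hP hd1 in
/-- **(ED. 2) S3 WITH AN ARBITRARY LEVEL ELEMENT `ϖ ≠ 0` — NO `hunr`** (ED. 1's proof uses unramifiedness only for `ι_w ϖ_v ≠ 0`; at a RAMIFIED place the level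
is measured by a uniformiser `π` of `L_w` with `σπ = −π`, B-p12 (g29) R-3 `K(m)` ∕ A-p19 (g23) R-0c level family — the (R5b-β) END brick's `hΨ`).  Same statement and proof as
ED. 1's S3 «LOCAL CONSTANCY OF THE COEFFICIENTS» (census `CENSUS-beta-HeadED2` §2), section-free form, with `ι_w ϖ_v` replaced by any non-zero `ϖ : L_w`.**  Let `ψ : H_v → Y` be LOCALLY CONSTANT and invariant under right
translation by `(E₂⁻¹ y, 1)` for every `y ∈ U` of level `m` (`ϖ_w^{−m}(y − 1) ∈ M₂(𝒪_w)` — the S2 package of A-p16 (g27), in the level-set form that is also ★ (H3)'s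
`hKm` antecedent).  Let `X : Z(t₀) → U` have matrix `↑↑(X t) = τ_i(t)_w • M` for a FIXED `M` (`τ_i(t) = (P⁻¹ t.1 P)_{ii}`; ★ (H3)∕(H4)'s normal-form witnesses read along
the torus), and `b : Z(t₀) → U(Φ₁)(L⁺_v)` be continuous.  Then `t ↦ ψ (E₂⁻¹ (X t), b t)` is locally constant on `Z(t₀)`: near `t`, `X t′ = X t · q` with
`↑↑q = (τ_i(t′)_w ∕ τ_i(t)_w) • 1` of level `m` (`v_w(τ_i(t′)_w − τ_i(t)_w) ≤ v_w(ϖ_w)^m` by continuity ★ `continuous_frameEntry_apply` and `v_w(τ_i(t)_w) = 1`), so the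
first argument may be frozen at `X t`; then `ψ` is locally constant in the second.  No continuous section of `U` is used.
[cite: Rogawski1990, §4.9 Lemma 4.9.3 p. 56; §3.6 pp. 31–32] [cite: LabesseLanglands1979, §2] [cite: BernsteinZelevinsky1976, §1.1] -/
theorem isLocallyConstant_apply_symm_frameScalar_of_ne_zero {Y : Type*}
    (E₂ : (cmDatum L 2 (Matrix.of fun i j : Fin 2 => if i.val + j.val + 1 = 2 then (1 : L) else 0)).Local v ≃ₜ*
      ↥(unitaryGroupOfForm (galAdicCompletionMap (L := L) (IsCMField.complexConj L) hw)
        (placeForm (Matrix.of fun i j : Fin 2 => if i.val + j.val + 1 = 2 then (1 : L) else 0) w.1)))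
    (ψ : ((cmDatum L 2 (Matrix.of fun i j : Fin 2 => if i.val + j.val + 1 = 2 then (1 : L) else 0)).Local v × (cmDatum L 1 (Matrix.of fun i j : Fin 1 => if i.val + j.val + 1 = 1 then (1 : L) else 0)).Local v) → Y)
    (hψlc : IsLocallyConstant ψ) (ϖ : w.1.adicCompletion L) (hϖ : ϖ ≠ 0) (m : ℕ)
    (hψ : ∀ (x : ((cmDatum L 2 (Matrix.of fun i j : Fin 2 => if i.val + j.val + 1 = 2 then (1 : L) else 0)).Local v × (cmDatum L 1 (Matrix.of fun i j : Fin 1 => if i.val + j.val + 1 = 1 then (1 : L) else 0)).Local v))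
        (y : ↥(unitaryGroupOfForm (galAdicCompletionMap (L := L) (IsCMField.complexConj L) hw) (placeForm (Matrix.of fun i j : Fin 2 => if i.val + j.val + 1 = 2 then (1 : L) else 0) w.1))),
        (∀ r s, ϖ ^ (-(m : ℤ)) *
          ((((y : ↥(unitaryGroupOfForm (galAdicCompletionMap (L := L) (IsCMField.complexConj L) hw) (placeForm (Matrix.of fun i j : Fin 2 => if i.val + j.val + 1 = 2 then (1 : L) else 0) w.1))) : GL (Fin 2) (w.1.adicCompletion L)) : Matrix (Fin 2) (Fin 2) (w.1.adicCompletion L)) - 1) r s ∈ 𝒪[w.1.adicCompletion L]) →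
        ψ (x * (E₂.symm y, 1)) = ψ x)
    (i : Fin 2) (M : Matrix (Fin 2) (Fin 2) (w.1.adicCompletion L))
    (X : ↥(Subgroup.centralizer ({t₀} : Set ((cmDatum L 2 (Matrix.of fun i j : Fin 2 => if i.val + j.val + 1 = 2 then (1 : L) else 0)).Local v × (cmDatum L 1 (Matrix.of fun i j : Fin 1 => if i.val + j.val + 1 = 1 then (1 : L) else 0)).Local v))) →
      ↥(unitaryGroupOfForm (galAdicCompletionMap (L := L) (IsCMField.complexConj L) hw) (placeForm (Matrix.of fun i j : Fin 2 => if i.val + j.val + 1 = 2 then (1 : L) else 0) w.1)))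
    (hX : ∀ t, (((X t : ↥(unitaryGroupOfForm (galAdicCompletionMap (L := L) (IsCMField.complexConj L) hw) (placeForm (Matrix.of fun i j : Fin 2 => if i.val + j.val + 1 = 2 then (1 : L) else 0) w.1))) : GL (Fin 2) (w.1.adicCompletion L)) : Matrix (Fin 2) (Fin 2) (w.1.adicCompletion L)) =
      ((((P⁻¹).val * ((t : ((cmDatum L 2 (Matrix.of fun i j : Fin 2 => if i.val + j.val + 1 = 2 then (1 : L) else 0)).Local v × (cmDatum L 1 (Matrix.of fun i j : Fin 1 => if i.val + j.val + 1 = 1 then (1 : L) else 0)).Local v)).1.val.val : Matrix (Fin 2) (Fin 2) (LocalRing L v)) * P.val) i i) w) • M)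
    (b : ↥(Subgroup.centralizer ({t₀} : Set ((cmDatum L 2 (Matrix.of fun i j : Fin 2 => if i.val + j.val + 1 = 2 then (1 : L) else 0)).Local v × (cmDatum L 1 (Matrix.of fun i j : Fin 1 => if i.val + j.val + 1 = 1 then (1 : L) else 0)).Local v))) →
      (cmDatum L 1 (Matrix.of fun i j : Fin 1 => if i.val + j.val + 1 = 1 then (1 : L) else 0)).Local v)
    (hb : Continuous b) :
    IsLocallyConstant (fun t : ↥(Subgroup.centralizer ({t₀} : Set ((cmDatum L 2 (Matrix.of fun i j : Fin 2 => if i.val + j.val + 1 = 2 then (1 : L) else 0)).Local v × (cmDatum L 1 (Matrix.of fun i j : Fin 1 => if i.val + j.val + 1 = 1 then (1 : L) else 0)).Local v))) =>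
      ψ (E₂.symm (X t), b t)) := by
  refine (IsLocallyConstant.iff_eventually_eq _).2 fun t => ?_
  -- the frame eigenvalue `c t = τ_i(t)_w`, abstracted: continuous, of valuation one, non-zero
  obtain ⟨c, hc_def⟩ : ∃ c : ↥(Subgroup.centralizer ({t₀} : Set ((cmDatum L 2 (Matrix.of fun i j : Fin 2 => if i.val + j.val + 1 = 2 then (1 : L) else 0)).Local v × (cmDatum L 1 (Matrix.of fun i j : Fin 1 => if i.val + j.val + 1 = 1 then (1 : L) else 0)).Local v))) → w.1.adicCompletion L,
      ∀ t, c t = (((P⁻¹).val * ((t : ((cmDatum L 2 (Matrix.of fun i j : Fin 2 => if i.val + j.val + 1 = 2 then (1 : L) else 0)).Local v × (cmDatum L 1 (Matrix.of fun i j : Fin 1 => if i.val + j.val + 1 = 1 then (1 : L) else 0)).Local v)).1.val.val : Matrix (Fin 2) (Fin 2) (LocalRing L v)) * P.val) i i) w := ⟨_, fun _ => rfl⟩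
  have hX' : ∀ t, (((X t : ↥(unitaryGroupOfForm (galAdicCompletionMap (L := L) (IsCMField.complexConj L) hw) (placeForm (Matrix.of fun i j : Fin 2 => if i.val + j.val + 1 = 2 then (1 : L) else 0) w.1))) : GL (Fin 2) (w.1.adicCompletion L)) : Matrix (Fin 2) (Fin 2) (w.1.adicCompletion L)) = c t • M := fun t => by
    rw [hc_def]; exact hX t
  have hc : Continuous c := by
    rw [show c = fun t : ↥(Subgroup.centralizer ({t₀} : Set ((cmDatum L 2 (Matrix.of fun i j : Fin 2 => if i.val + j.val + 1 = 2 then (1 : L) else 0)).Local v × (cmDatum L 1 (Matrix.of fun i j : Fin 1 => if i.val + j.val + 1 = 1 then (1 : L) else 0)).Local v))) => (((P⁻¹).val * ((t : ((cmDatum L 2 (Matrix.of fun i j : Fin 2 => if i.val + j.val + 1 = 2 then (1 : L) else 0)).Local v × (cmDatum L 1 (Matrix.of fun i j : Fin 1 => if i.val + j.val + 1 = 1 then (1 : L) else 0)).Local v)).1.val.val : Matrix (Fin 2) (Fin 2) (LocalRing L v)) * P.val) i i) w from funext hc_def]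
    exact (continuous_frameEntry_apply L v P i i w).comp continuous_subtype_val
  have hc1 : ∀ t, Valued.v (c t) = 1 := fun t => by
    rw [hc_def]; exact valued_apply_eq_one_of_conjLocal_mul_self L v w hw (conjLocal_frameEntry_mul_self_apply L v w hw t₀ P d ht₀ hP hd1 t i)
  have hc0 : ∀ t, c t ≠ 0 := fun t h => by
    have h1 := hc1 t
    rw [h, map_zero] at h1
    exact zero_ne_one h1
  have hϖ0 : ϖ ≠ 0 := hϖ
  -- (1) eventually the eigenvalue moves by less than `ϖ_w^m` (through the normalised absolute value of `L_w`)
  have h1 : ∀ᶠ t' : ↥(Subgroup.centralizer ({t₀} : Set ((cmDatum L 2 (Matrix.of fun i j : Fin 2 => if i.val + j.val + 1 = 2 then (1 : L) else 0)).Local v × (cmDatum L 1 (Matrix.of fun i j : Fin 1 => if i.val + j.val + 1 = 1 then (1 : L) else 0)).Local v))) in 𝓝 t, Valued.v (c t' - c t) < Valued.v ϖ ^ m := by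
    have ht : Tendsto (fun t' : ↥(Subgroup.centralizer ({t₀} : Set ((cmDatum L 2 (Matrix.of fun i j : Fin 2 => if i.val + j.val + 1 = 2 then (1 : L) else 0)).Local v × (cmDatum L 1 (Matrix.of fun i j : Fin 1 => if i.val + j.val + 1 = 1 then (1 : L) else 0)).Local v))) => c t' - c t) (𝓝 t) (𝓝 0) := by
      have h := (hc.tendsto t).sub_const (c t)
      rwa [sub_self] at h
    have hπ' : 0 < ‖ϖ ^ m‖ := norm_pos_iff.2 (pow_ne_zero m hϖ0)
    filter_upwards [(NormedAddGroup.tendsto_nhds_zero.1 ht) _ hπ'] with t' ht'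
    rw [← map_pow]
    exact Valued.toNormedField.norm_lt_iff.1 ht'
  -- (2) eventually the second component stays where `ψ (E₂⁻¹ (X t), ·)` is constant
  have h2 : ∀ᶠ t' : ↥(Subgroup.centralizer ({t₀} : Set ((cmDatum L 2 (Matrix.of fun i j : Fin 2 => if i.val + j.val + 1 = 2 then (1 : L) else 0)).Local v × (cmDatum L 1 (Matrix.of fun i j : Fin 1 => if i.val + j.val + 1 = 1 then (1 : L) else 0)).Local v))) in 𝓝 t, ψ (E₂.symm (X t), b t') = ψ (E₂.symm (X t), b t) := by
    have hlc : IsLocallyConstant (fun a : (cmDatum L 1 (Matrix.of fun i j : Fin 1 => if i.val + j.val + 1 = 1 then (1 : L) else 0)).Local v => ψ (E₂.symm (X t), a)) :=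
      hψlc.comp_continuous (continuous_const.prodMk continuous_id)
    exact (hb.tendsto t).eventually ((IsLocallyConstant.iff_eventually_eq _).1 hlc (b t))
  filter_upwards [h1, h2] with t' h1' h2'
  -- the quotient `q := (X t)⁻¹ * X t'` is the scalar `(c t' / c t) • 1`
  have hXt' : (((X t' : ↥(unitaryGroupOfForm (galAdicCompletionMap (L := L) (IsCMField.complexConj L) hw) (placeForm (Matrix.of fun i j : Fin 2 => if i.val + j.val + 1 = 2 then (1 : L) else 0) w.1))) : GL (Fin 2) (w.1.adicCompletion L)) : Matrix (Fin 2) (Fin 2) (w.1.adicCompletion L)) =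
      (((X t : ↥(unitaryGroupOfForm (galAdicCompletionMap (L := L) (IsCMField.complexConj L) hw) (placeForm (Matrix.of fun i j : Fin 2 => if i.val + j.val + 1 = 2 then (1 : L) else 0) w.1))) : GL (Fin 2) (w.1.adicCompletion L)) : Matrix (Fin 2) (Fin 2) (w.1.adicCompletion L)) * ((c t' / c t) • (1 : Matrix (Fin 2) (Fin 2) (w.1.adicCompletion L))) := by
    rw [hX' t', hX' t, Matrix.smul_mul, Matrix.mul_smul, Matrix.mul_one, smul_smul, mul_div_assoc', mul_div_cancel_left₀ _ (hc0 t)]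
  have hq : ((((X t)⁻¹ * X t' : ↥(unitaryGroupOfForm (galAdicCompletionMap (L := L) (IsCMField.complexConj L) hw) (placeForm (Matrix.of fun i j : Fin 2 => if i.val + j.val + 1 = 2 then (1 : L) else 0) w.1))) : GL (Fin 2) (w.1.adicCompletion L)) : Matrix (Fin 2) (Fin 2) (w.1.adicCompletion L)) =
      (c t' / c t) • (1 : Matrix (Fin 2) (Fin 2) (w.1.adicCompletion L)) := by
    rw [Subgroup.coe_mul, Subgroup.coe_inv, Units.val_mul, hXt', Units.inv_mul_cancel_left]
  -- hence `q` is of level `m`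
  have hlev : ∀ r s, ϖ ^ (-(m : ℤ)) *
      (((((X t)⁻¹ * X t' : ↥(unitaryGroupOfForm (galAdicCompletionMap (L := L) (IsCMField.complexConj L) hw) (placeForm (Matrix.of fun i j : Fin 2 => if i.val + j.val + 1 = 2 then (1 : L) else 0) w.1))) : GL (Fin 2) (w.1.adicCompletion L)) : Matrix (Fin 2) (Fin 2) (w.1.adicCompletion L)) - 1) r s ∈ 𝒪[w.1.adicCompletion L] := by
    intro r s
    have hsub : ∀ a : w.1.adicCompletion L, a • (1 : Matrix (Fin 2) (Fin 2) (w.1.adicCompletion L)) - 1 = (a - 1) • (1 : Matrix (Fin 2) (Fin 2) (w.1.adicCompletion L)) :=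
      fun a => by rw [sub_smul, one_smul]
    rw [hq, hsub, Matrix.smul_apply, Matrix.one_apply, smul_eq_mul]
    split_ifs with hrs
    · rw [mul_one, zpow_neg_mul_mem_integer_iff hϖ0, div_sub_one (hc0 t), map_div₀, hc1 t, div_one]
      exact h1'.le
    · rw [mul_zero, mul_zero]
      exact (Valuation.mem_integer_iff _ _).2 (by rw [map_zero]; exact zero_le)
  -- conclude: freeze the first argument by the S2 invariance, then move the second
  have hXq : X t' = X t * ((X t)⁻¹ * X t') := by rw [mul_inv_cancel_left]
  calc ψ (E₂.symm (X t'), b t')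
      = ψ ((E₂.symm (X t), b t') * (E₂.symm ((X t)⁻¹ * X t'), 1)) := by
        rw [Prod.mk_mul_mk, ← map_mul, ← hXq, mul_one]
    _ = ψ (E₂.symm (X t), b t') := hψ _ _ hlev
    _ = ψ (E₂.symm (X t), b t) := h2'

include hw ht₀ hP hd1 in
/-- **(ED. 2) the `_of_ne_zero` form at the torus' own second component** `b t := t.2` (the shape used by the fold S5: `ψm_k t = φ_k (E₂⁻¹ (xm t), t.2)`, `ψ_k i t = φ_k (E₂⁻¹ (x i t), t.2)`).
[cite: Rogawski1990, §4.9 Lemma 4.9.3 p. 56] [cite: LabesseLanglands1979, §2] -/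
theorem isLocallyConstant_apply_symm_frameScalar_snd_of_ne_zero {Y : Type*}
    (E₂ : (cmDatum L 2 (Matrix.of fun i j : Fin 2 => if i.val + j.val + 1 = 2 then (1 : L) else 0)).Local v ≃ₜ*
      ↥(unitaryGroupOfForm (galAdicCompletionMap (L := L) (IsCMField.complexConj L) hw)
        (placeForm (Matrix.of fun i j : Fin 2 => if i.val + j.val + 1 = 2 then (1 : L) else 0) w.1)))
    (ψ : ((cmDatum L 2 (Matrix.of fun i j : Fin 2 => if i.val + j.val + 1 = 2 then (1 : L) else 0)).Local v × (cmDatum L 1 (Matrix.of fun i j : Fin 1 => if i.val + j.val + 1 = 1 then (1 : L) else 0)).Local v) → Y)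
    (hψlc : IsLocallyConstant ψ) (ϖ : w.1.adicCompletion L) (hϖ : ϖ ≠ 0) (m : ℕ)
    (hψ : ∀ (x : ((cmDatum L 2 (Matrix.of fun i j : Fin 2 => if i.val + j.val + 1 = 2 then (1 : L) else 0)).Local v × (cmDatum L 1 (Matrix.of fun i j : Fin 1 => if i.val + j.val + 1 = 1 then (1 : L) else 0)).Local v))
        (y : ↥(unitaryGroupOfForm (galAdicCompletionMap (L := L) (IsCMField.complexConj L) hw) (placeForm (Matrix.of fun i j : Fin 2 => if i.val + j.val + 1 = 2 then (1 : L) else 0) w.1))),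
        (∀ r s, ϖ ^ (-(m : ℤ)) *
          ((((y : ↥(unitaryGroupOfForm (galAdicCompletionMap (L := L) (IsCMField.complexConj L) hw) (placeForm (Matrix.of fun i j : Fin 2 => if i.val + j.val + 1 = 2 then (1 : L) else 0) w.1))) : GL (Fin 2) (w.1.adicCompletion L)) : Matrix (Fin 2) (Fin 2) (w.1.adicCompletion L)) - 1) r s ∈ 𝒪[w.1.adicCompletion L]) →
        ψ (x * (E₂.symm y, 1)) = ψ x)
    (i : Fin 2) (M : Matrix (Fin 2) (Fin 2) (w.1.adicCompletion L))
    (X : ↥(Subgroup.centralizer ({t₀} : Set ((cmDatum L 2 (Matrix.of fun i j : Fin 2 => if i.val + j.val + 1 = 2 then (1 : L) else 0)).Local v × (cmDatum L 1 (Matrix.of fun i j : Fin 1 => if i.val + j.val + 1 = 1 then (1 : L) else 0)).Local v))) →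
      ↥(unitaryGroupOfForm (galAdicCompletionMap (L := L) (IsCMField.complexConj L) hw) (placeForm (Matrix.of fun i j : Fin 2 => if i.val + j.val + 1 = 2 then (1 : L) else 0) w.1)))
    (hX : ∀ t, (((X t : ↥(unitaryGroupOfForm (galAdicCompletionMap (L := L) (IsCMField.complexConj L) hw) (placeForm (Matrix.of fun i j : Fin 2 => if i.val + j.val + 1 = 2 then (1 : L) else 0) w.1))) : GL (Fin 2) (w.1.adicCompletion L)) : Matrix (Fin 2) (Fin 2) (w.1.adicCompletion L)) =
      ((((P⁻¹).val * ((t : ((cmDatum L 2 (Matrix.of fun i j : Fin 2 => if i.val + j.val + 1 = 2 then (1 : L) else 0)).Local v × (cmDatum L 1 (Matrix.of fun i j : Fin 1 => if i.val + j.val + 1 = 1 then (1 : L) else 0)).Local v)).1.val.val : Matrix (Fin 2) (Fin 2) (LocalRing L v)) * P.val) i i) w) • M) :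
    IsLocallyConstant (fun t : ↥(Subgroup.centralizer ({t₀} : Set ((cmDatum L 2 (Matrix.of fun i j : Fin 2 => if i.val + j.val + 1 = 2 then (1 : L) else 0)).Local v × (cmDatum L 1 (Matrix.of fun i j : Fin 1 => if i.val + j.val + 1 = 1 then (1 : L) else 0)).Local v))) =>
      ψ (E₂.symm (X t), (t : ((cmDatum L 2 (Matrix.of fun i j : Fin 2 => if i.val + j.val + 1 = 2 then (1 : L) else 0)).Local v × (cmDatum L 1 (Matrix.of fun i j : Fin 1 => if i.val + j.val + 1 = 1 then (1 : L) else 0)).Local v)).2)) :=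
  isLocallyConstant_apply_symm_frameScalar_of_ne_zero L v w hw t₀ P d ht₀ hP hd1 E₂ ψ hψlc ϖ hϖ m hψ i M X hX _ (continuous_snd.comp continuous_subtype_val)

end CoefficientsOfNeZero

end Literature.NumberTheory.Rogawski1990

end
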